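import Mathlib
import Literature.Topology.PlaneTopology.Schoenflies
import Literature.Probability.RandomPlanarGeometry.PlanarDomainsTopology

/-!
# Normal form of a crossing path of a conformal rectangle (Schoenflies)

Helper file for item `NoiseDiscretisation` (stmt-CriticalPhenomena-4598) of route
`CardyWhiteToColoured` (`CardyFormulaZ2`).

`exists_path_inner_of_posCross`: if a conformal rectangle `R = (Ω; arcs 0–3)` is crossed from
`arc 0` to `arc 2` by a path in `closure Ω` lying in an open set `U` (e.g. `U = {F > c}` for a
continuous field `F`), then it is also crossed inside `U` by a path which meets `∂Ω` only at its two
end-points, and these are *interior* points of `arc 0` and `arc 2` (boundary parameters strictly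
between the marks). Proof: by the Carathéodory–Schoenflies theorem of the tree
(`JordanDomain.exists_homeomorph_closedBall_closure`: `closure Ω` is a closed disc `𝔻̄`, with
`∂Ω ↔ ∂𝔻` and `Ω ↔ 𝔻`) the path is pulled back to `𝔻̄`, its end-points are moved slightly along
the circle to interior parameters, and it is pushed radially into the open disc by the factor
`1 − s·b(t)` (`b` a tent vanishing exactly at `t = 0, 1`), `s` a Lebesgue number of the pulled-back
open set around the compact path.

References: Ch. Pommerenke, *Boundary Behaviour of Conformal Maps* (1992), §2.3 Cor. 2.8;
S. Smirnov, C. R. Acad. Sci. Paris 333 (2001), §2.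
-/

noncomputable section

namespace Summit.CriticalPhenomena.CardyFormulaZ2.Theorems

namespace WhiteToColoured

open Set Metric Filter Topology unitInterval
open Literature.Probability.RandomPlanarGeometry

/-- **Normal form of a crossing path.** See the module docstring. -/
theorem exists_path_inner_of_posCross (R : ConformalRectangle) {U : Set ℂ} (hU : IsOpen U)
    {x y : ℂ} (hx : x ∈ R.arc 0) (hy : y ∈ R.arc 2) (γ : Path x y)
    (hγ : ∀ t, γ t ∈ closure R.carrier ∧ γ t ∈ U) :
    ∃ s₀ ∈ Ioo (R.mark 0) (R.nextMark 0), ∃ s₂ ∈ Ioo (R.mark 2) (R.nextMark 2),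
      ∃ Γ : Path (R.boundary s₀) (R.boundary s₂),
        (∀ t, Γ t ∈ closure R.carrier ∧ Γ t ∈ U) ∧
        ∀ t : unitInterval, (t : ℝ) ≠ 0 → (t : ℝ) ≠ 1 → Γ t ∈ R.carrier := by
  obtain ⟨h, hfr, hin⟩ := R.toJordanDomain.exists_homeomorph_closedBall_closure
  -- pull back the path and the open set to the closed disc `D`
  let D : Set ℂ := closedBall (0 : ℂ) 1
  set V : Set D := {w | (h w : ℂ) ∈ U} with hV
  have hVo : IsOpen V := hU.preimage (continuous_subtype_val.comp h.continuous)
  let γ' : unitInterval → D := fun t => h.symm ⟨γ t, (hγ t).1⟩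
  have hγ'c : Continuous γ' := h.symm.continuous.comp (γ.continuous.subtype_mk _)
  have hγ'h : ∀ t, (h (γ' t) : ℂ) = γ t := fun t => by simp [γ']
  have hγ'V : ∀ t, γ' t ∈ V := fun t => by
    show (h (γ' t) : ℂ) ∈ U
    rw [hγ'h]; exact (hγ t).2
  -- a Lebesgue number `s` of `V` around the compact path
  obtain ⟨s, hs, hsV⟩ : ∃ s > 0, ∀ w : D, ∀ t, dist w (γ' t) < s → w ∈ V := by
    obtain ⟨s, hs, hsub⟩ := (isCompact_range hγ'c).exists_thickening_subset_open hVo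
      (range_subset_iff.2 hγ'V)
    exact ⟨s, hs, fun w t hw => hsub (mem_thickening_iff.2 ⟨γ' t, mem_range_self t, hw⟩)⟩
  -- boundary parametrisation pulled back to the circle
  have hbd : ∀ u : ℝ, R.boundary u ∈ closure R.carrier := fun u =>
    frontier_subset_closure (R.boundary_mem_frontier u)
  let β : ℝ → D := fun u => h.symm ⟨R.boundary u, hbd u⟩
  have hβc : Continuous β := h.symm.continuous.comp (R.continuous_boundary.subtype_mk _)
  have hβh : ∀ u, (h (β u) : ℂ) = R.boundary u := fun u => by simp [β]
  have hβnorm : ∀ u, ‖(β u : ℂ)‖ = 1 := fun u =>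
    (hfr (β u)).1 (by rw [hβh]; exact R.boundary_mem_frontier u)
  -- interior parameters close to the end-points
  have hends : ∀ (i : Fin 4) (z : ℂ), z ∈ R.arc i → ∀ w : D, (h w : ℂ) = z →
      ∃ s' ∈ Ioo (R.mark i) (R.nextMark i), dist (β s') w < s / 4 := by
    intro i z hz w hw
    obtain ⟨u, hu, rfl⟩ := hz
    have hwu : w = β u := by
      apply h.injective
      ext
      rw [hw, hβh]
    have hc : ContinuousAt β u := hβc.continuousAt
    rw [Metric.continuousAt_iff] at hc
    obtain ⟨η, hη, hηs⟩ := hc (s / 4) (by positivity)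
    -- a parameter of the open interval within `η` of `u ∈ [mark i, nextMark i]`
    have hlt := R.mark_lt_nextMark i
    obtain ⟨s', hs', hs'u⟩ : ∃ s' ∈ Ioo (R.mark i) (R.nextMark i), dist s' u < η := by
      set η' := min η ((R.nextMark i - R.mark i) / 2) with hη'
      have hη'0 : 0 < η' := lt_min hη (by linarith)
      have hη'1 : η' ≤ η := min_le_left _ _
      have hη'2 : η' ≤ (R.nextMark i - R.mark i) / 2 := min_le_right _ _
      by_cases h1 : u + η' / 2 < R.nextMark i
      · refine ⟨u + η' / 2, ⟨by linarith [hu.1], h1⟩, ?_⟩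
        rw [Real.dist_eq, show u + η' / 2 - u = η' / 2 by ring, abs_of_pos (by positivity)]
        linarith
      · push Not at h1
        refine ⟨u - η' / 2, ⟨by linarith [hu.2], by linarith [hu.2]⟩, ?_⟩
        rw [Real.dist_eq, show u - η' / 2 - u = -(η' / 2) by ring, abs_neg,
          abs_of_pos (by positivity)]
        linarith
    exact ⟨s', hs', by rw [hwu]; exact hηs hs'u⟩
  obtain ⟨s₀, hs₀, hd₀⟩ := hends 0 x hx (γ' 0) (by rw [hγ'h, γ.source])
  obtain ⟨s₂, hs₂, hd₂⟩ := hends 2 y hy (γ' 1) (by rw [hγ'h, γ.target])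
  refine ⟨s₀, hs₀, s₂, hs₂, ?_⟩
  -- the position path `q` in the closed disc (as a path in `ℂ`): β s₀ → γ' 0 → γ' → γ' 1 → β s₂
  set u₀ : ℂ := (β s₀ : ℂ) with hu₀
  set u₂ : ℂ := (β s₂ : ℂ) with hu₂
  let γ'' : Path ((γ' 0 : D) : ℂ) ((γ' 1 : D) : ℂ) :=
    { toFun := fun t => (γ' t : ℂ)
      continuous_toFun := continuous_subtype_val.comp hγ'c
      source' := rfl
      target' := rfl }
  let q : Path u₀ u₂ := ((Path.segment u₀ (γ' 0 : ℂ)).trans γ'').trans (Path.segment (γ' 1 : ℂ) u₂)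
  have hs1 : min s 1 ≤ 1 := min_le_right _ _
  have hs0 : 0 < min s 1 := lt_min hs one_pos
  -- norms along `q` are at most `1`, and `q` stays within `s/2` of the pulled-back path
  have hnorm1 : ∀ w : D, ‖(w : ℂ)‖ ≤ 1 := fun w => mem_closedBall_zero_iff.1 w.2
  have hsegD : ∀ a b : D, ∀ z ∈ segment ℝ (a : ℂ) (b : ℂ), ‖z‖ ≤ 1 := fun a b z hz =>
    mem_closedBall_zero_iff.1 ((convex_closedBall (0 : ℂ) 1).segment_subset
      (mem_closedBall_zero_iff.2 (hnorm1 a)) (mem_closedBall_zero_iff.2 (hnorm1 b)) hz)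
  have hsegd : ∀ (a p z : ℂ), z ∈ segment ℝ a p → dist z p ≤ dist a p := fun a p z hz =>
    mem_closedBall.1 ((convex_closedBall p (dist a p)).segment_subset
      (mem_closedBall.2 le_rfl) (mem_closedBall_self dist_nonneg) hz)
  have hd₀' : dist u₀ ((γ' 0 : D) : ℂ) < s / 4 := by
    have := hd₀; rwa [Subtype.dist_eq] at this
  have hd₂' : dist u₂ ((γ' 1 : D) : ℂ) < s / 4 := by
    have := hd₂; rwa [Subtype.dist_eq] at this
  have hq : ∀ t, ‖q t‖ ≤ 1 ∧ ∃ t', dist (q t) (γ' t' : ℂ) < s / 2 := by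
    intro t
    have hmem : q t ∈ range q := mem_range_self t
    rw [Path.trans_range, Path.trans_range, Path.range_segment, Path.range_segment] at hmem
    rcases hmem with (hm | hm) | hm
    · exact ⟨hsegD _ _ _ hm, 0, by linarith [hsegd _ _ _ hm]⟩
    · obtain ⟨t', ht'⟩ := hm
      have hqt : q t = (γ' t' : ℂ) := ht'.symm
      exact ⟨by rw [hqt]; exact hnorm1 _, t', by rw [hqt, dist_self]; positivity⟩
    · refine ⟨hsegD _ _ _ hm, 1, ?_⟩
      rw [segment_symm] at hm
      linarith [hsegd _ _ _ hm]
  -- radial push by the factor `ρ t = 1 - (min s 1 / 4) · tent t`, `tent t = min t (1 - t)`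
  set tent : unitInterval → ℝ := fun t => min (t : ℝ) (1 - t) with htent
  have tent_nonneg : ∀ t, 0 ≤ tent t := fun t => le_min t.2.1 (by linarith [t.2.2])
  have tent_le_one : ∀ t, tent t ≤ 1 := fun t => (min_le_left _ _).trans t.2.2
  have tent_pos : ∀ t : unitInterval, (t : ℝ) ≠ 0 → (t : ℝ) ≠ 1 → 0 < tent t := fun t h0 h1 =>
    lt_min (lt_of_le_of_ne t.2.1 (Ne.symm h0)) (by
      have := lt_of_le_of_ne t.2.2 h1
      linarith)
  have continuous_tent : Continuous tent :=
    (continuous_subtype_val).min (continuous_const.sub continuous_subtype_val)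
  set ρ : unitInterval → ℝ := fun t => 1 - min s 1 / 4 * tent t with hρ
  have hρc : Continuous ρ := continuous_const.sub (continuous_const.mul continuous_tent)
  have hρ_le : ∀ t, ρ t ≤ 1 := fun t => by
    have := tent_nonneg t; simp only [hρ]; nlinarith
  have hρ_pos : ∀ t, 0 < ρ t := fun t => by
    have := tent_le_one t; simp only [hρ]; nlinarith
  have hρ_lt : ∀ t : unitInterval, (t : ℝ) ≠ 0 → (t : ℝ) ≠ 1 → ρ t < 1 := fun t h0 h1 => by
    have := tent_pos t h0 h1; simp only [hρ]; nlinarith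
  have hρ_sub : ∀ t, |ρ t - 1| ≤ s / 4 := fun t => by
    have h1 := tent_nonneg t; have h2 := tent_le_one t
    rw [abs_le]; simp only [hρ]; constructor <;> nlinarith [min_le_left s 1]
  have hρ0 : ρ 0 = 1 := by simp [hρ, htent]
  have hρ1 : ρ 1 = 1 := by simp [hρ, htent]
  -- the pushed path lies in the closed disc
  have hwD : ∀ t, (ρ t : ℂ) * q t ∈ D := fun t => by
    show (ρ t : ℂ) * q t ∈ closedBall (0 : ℂ) 1
    rw [mem_closedBall_zero_iff, norm_mul, Complex.norm_real, Real.norm_eq_abs,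
      abs_of_pos (hρ_pos t)]
    calc ρ t * ‖q t‖ ≤ 1 * 1 := mul_le_mul (hρ_le t) (hq t).1 (norm_nonneg _) zero_le_one
      _ = 1 := one_mul 1
  let wD : unitInterval → D := fun t => ⟨(ρ t : ℂ) * q t, hwD t⟩
  have hwDc : Continuous wD :=
    ((Complex.continuous_ofReal.comp hρc).mul q.continuous).subtype_mk _
  -- it stays within `s` of the pulled-back path, hence inside `V`
  have hwV : ∀ t, wD t ∈ V := by
    intro t
    obtain ⟨t', ht'⟩ := (hq t).2
    refine hsV (wD t) t' ?_
    rw [Subtype.dist_eq]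
    show dist ((ρ t : ℂ) * q t) (γ' t' : ℂ) < s
    have h1 : dist ((ρ t : ℂ) * q t) (q t) ≤ s / 4 := by
      rw [dist_eq_norm, show (ρ t : ℂ) * q t - q t = ((ρ t - 1 : ℝ) : ℂ) * q t by push_cast; ring,
        norm_mul, Complex.norm_real, Real.norm_eq_abs]
      calc |ρ t - 1| * ‖q t‖ ≤ s / 4 * 1 :=
            mul_le_mul (hρ_sub t) (hq t).1 (norm_nonneg _) (by positivity)
        _ = s / 4 := mul_one _
    linarith [dist_triangle ((ρ t : ℂ) * q t) (q t) (γ' t' : ℂ)]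
  -- the final path
  have hw0 : wD 0 = β s₀ := by
    ext
    show (ρ 0 : ℂ) * q 0 = u₀
    rw [hρ0, q.source]; simp
  have hw1 : wD 1 = β s₂ := by
    ext
    show (ρ 1 : ℂ) * q 1 = u₂
    rw [hρ1, q.target]; simp
  let Γ : Path (R.boundary s₀) (R.boundary s₂) :=
    { toFun := fun t => (h (wD t) : ℂ)
      continuous_toFun := continuous_subtype_val.comp (h.continuous.comp hwDc)
      source' := by
        show (h (wD 0) : ℂ) = R.boundary s₀
        rw [hw0, hβh]
      target' := by
        show (h (wD 1) : ℂ) = R.boundary s₂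
        rw [hw1, hβh] }
  refine ⟨Γ, fun t => ⟨(h (wD t)).2, hwV t⟩, fun t h0 h1 => ?_⟩
  show (h (wD t) : ℂ) ∈ R.carrier
  rw [hin]
  show ‖(ρ t : ℂ) * q t‖ < 1
  rw [norm_mul, Complex.norm_real, Real.norm_eq_abs, abs_of_pos (hρ_pos t)]
  calc ρ t * ‖q t‖ ≤ ρ t * 1 := mul_le_mul_of_nonneg_left (hq t).1 (hρ_pos t).le
    _ < 1 := by rw [mul_one]; exact hρ_lt t h0 h1

end WhiteToColoured

end Summit.CriticalPhenomena.CardyFormulaZ2.Theorems
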